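import Summits.NavierStokesRegularity.NavierStokesRegularity.Theorems.AxisymmetricSwirlRegularityKatoGlobal
import Summits.NavierStokesRegularity.NavierStokesRegularity.Theses.TypeIIInviscidRelaxation
import HarnessLib

/-!
# Crux `MonopoleCoreExclusion` (stmt-NavierStokesRegularity-1965), line `axisymmetric_comparison_flow`:
# the Clay-(A) form of `AxisymSwirlRegular` already yields SYMMETRIC, SLAB-BOUNDED classical continuations

`--supports stmt-NavierStokesRegularity-1965` (helper file; theorems only, no definitions, no `sorry`).

The repair censuses of hands 4-g0 / 6-g0 / 6-g1 flagged the transfer stub `stub_axisymComparisonFlowOfAX` as misstated: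
its hypothesis `AxisymSwirlRegular` (Clay-(A) form — SOME global classical solution with bounded energy) says nothing about
symmetry or boundedness of the continuation.  This file REPAIRS THE GAP INSIDE THE TREE instead of restating the stub:
from `AxisymSwirlRegular` it derives, for every `ν > 0`, horizon `τ > 0` and smooth divergence-free rapidly decaying
axisymmetric datum, a classical solution on `[0, τ] × ℝ³` from that datum which is axisymmetric at every time and bounded
(`slabAxisym_of_axisymSwirlRegular`).  Mechanism (the tree's Kato/Tao machinery, as in
`axisymmetricSwirlRegularity_of_noBlowup`): if the Kato maximal time `T*` of the datum were finite, the maximal Kato solution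
has a singular point `(T*, x₁)` (`lemarieRieusset_singular_point_of_blowup_holds`); the Clay-(A) solution is Leray–Hopf on
every `[0, T']` by Tao 2011 Lemma 8.1 (`IsClassicalNSSolutionOn.isLerayHopfOn_of_finiteEnergy`, all three named facts
discharged in the tree), hence agrees a.e. with the bounded Tao-class patches of the Kato solution by weak–strong uniqueness
(`weak_strong_uniqueness_holds`), and being jointly continuous it is bounded near `(T*, x₁)` — contradiction.  So `T* = ∞`,
and the Tao-class solution on `[0, τ]` (`exists_isTaoSolutionOn_of_isKatoSolutionOn`) is classical, axisymmetric
(`IsTaoSolutionOn.isAxisymmetric`) and bounded (`exists_bound_velocity`).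
HONEST: conditional on the open conjecture `AxisymSwirlRegular` (a hypothesis); nothing about Navier–Stokes regularity is
claimed.  (Revision: the proofs now delegate to the route-independent engine `AxisymmetricSwirlRegularityKatoGlobal` — same
statements, the route decl `AxisymSwirlRegular` unfolds to the conjecture leaf `AxisymmetricSwirlRegularity`.)
-/

noncomputable section

open Literature.Analysis.FluidPDE MeasureTheory Set Function Filter Topology Metric
open scoped ContDiff InnerProductSpace RealInnerProductSpace

namespace Summit.NavierStokesRegularity.NavierStokesRegularity.Theorems

-- the problem directory repeats the summit name (`NavierStokesRegularity/NavierStokesRegularity`)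
set_option linter.dupNamespace false

namespace AxisymComparisonFlow

/-- **`AxisymSwirlRegular` (Clay-(A) form) ⇒ the Kato maximal time of every smooth divergence-free rapidly decaying
axisymmetric datum is infinite.**  (Tao 2011 Lemma 8.1: the Clay solution is Leray–Hopf on every slab; weak–strong
uniqueness against the Tao-class patches of the maximal Kato solution; joint continuity of the Clay solution near the
singular point of a finite maximal time.) [cite: Tao2011, Lemma 8.1] -/
theorem katoMaximalTime_eq_top_of_axisymSwirlRegular
    (hAX : Summit.NavierStokesRegularity.NavierStokesRegularity.Theses.TypeIIInviscidRelaxation.AxisymSwirlRegular)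
    {ν : ℝ} (hν : 0 < ν) {u₀ : EuclideanSpace ℝ (Fin 3) → EuclideanSpace ℝ (Fin 3)} (hsm : ContDiff ℝ ∞ u₀)
    (hdiv : VectorCalculus.IsDivFree u₀) (hdec : HasRapidSpatialDecay u₀) (haxi : IsAxisymmetric u₀) :
    katoMaximalTime ν u₀ = ⊤ :=
  AxisymKatoGlobal.katoMaximalTime_eq_top_of_axisymmetricSwirlRegularity
    (fun ν hν u₀ hsm hdiv hdec hax => hAX ν hν u₀ hsm hdiv hdec hax) hν hsm hdiv hdec haxi

/-- **`AxisymSwirlRegular` (Clay-(A) form) ⇒ symmetric, slab-bounded classical continuations.**  For `ν > 0`, any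
horizon `τ > 0` and a smooth, divergence-free, rapidly decaying, axisymmetric datum `u₀` there is a classical solution
`(u, p)` of the unforced system on `[0, τ] × ℝ³` with `u 0 = u₀`, axisymmetric at every time of `[0, τ]` and bounded on
`[0, τ] × ℝ³` (the Tao-class solution of the global Kato solution).  This is the STRONG form of the conjecture needed by
the transfer stub of the line. [cite: Tao2011, Lemma 8.1] -/
theorem slabAxisym_of_axisymSwirlRegular
    (hAX : Summit.NavierStokesRegularity.NavierStokesRegularity.Theses.TypeIIInviscidRelaxation.AxisymSwirlRegular) :
    ∀ ν : ℝ, 0 < ν → ∀ τ : ℝ, 0 < τ → ∀ u₀ : EuclideanSpace ℝ (Fin 3) → EuclideanSpace ℝ (Fin 3),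
      ContDiff ℝ ∞ u₀ → VectorCalculus.IsDivFree u₀ → HasRapidSpatialDecay u₀ → IsAxisymmetric u₀ →
      ∃ (u : ℝ → EuclideanSpace ℝ (Fin 3) → EuclideanSpace ℝ (Fin 3)) (p : ℝ → EuclideanSpace ℝ (Fin 3) → ℝ),
        IsClassicalNSSolutionOn (Icc 0 τ) ν 0 u p ∧ u 0 = u₀ ∧ (∀ s ∈ Icc 0 τ, IsAxisymmetric (u s)) ∧
        ∃ M : ℝ, ∀ s ∈ Icc 0 τ, ∀ x, ‖u s x‖ ≤ M :=
  AxisymKatoGlobal.slabAxisym_of_axisymmetricSwirlRegularity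
    (fun ν hν u₀ hsm hdiv hdec hax => hAX ν hν u₀ hsm hdiv hdec hax)

end AxisymComparisonFlow

end Summit.NavierStokesRegularity.NavierStokesRegularity.Theorems

end
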